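import Summits.QuantumAdvantage.QuantumAdvantage.Theorems.CubicForrelationNearExactIsExactAxParity
import HarnessLib

/-!
# Parity of the exactly-covering `5`-sets of monomials on 14 variables (NearExactIsExact, disprover's structure file)

Negative-side STRUCTURE for the crux `CubicForrelation.NearExactIsExact` (item `near_exact_is_exact`,
stmt-QuantumAdvantage-14043) at `n = 14`, from the B2b disprover seat (gen 15): the purely combinatorial half of
`NoConstantResidueFourteen` (no cubic `g : 𝔽₂¹⁴ → 𝔽₂` has `W_g/32 ≡ c (mod 8)` everywhere with `c` odd).
HONEST FRAMING: an elementary counting theorem about families of monomials of degree `≤ 3` on `14` variables,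
NOT summit progress.

For a polynomial `p` over `𝔽₂` in `14` variables of total degree `≤ 3` put `U_S = ⋃_{s ∈ S} supp s` and
`N_m(K) = #{S ⊆ Mon(p) : |S| = m, U_S = K}`.

**Theorem (`even_cov_five`).** If `N₄(K)` is even for every `K` with `|K| ∈ {11, 12}`, then `N₅(univ)` is even.

Proof, with `mult_S(v) = #{s ∈ S : v ∈ supp s}` for a covering `5`-set `S` (`U_S = univ`):
(i) for each variable `v`, the covering `5`-sets in which `v` is simply covered are in bijection (remove the member
through `v`) with the pairs `(s ∋ v, S')`, `S'` a `4`-set with `v ∉ U_{S'}` and `U_{S'} ∪ supp s = univ`, so that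
`|U_{S'}| ∈ {11, 12}` (or `N₄ = 0`), and their number is even (`filter_simply_eq_biUnion`, `even_card_simply`);
(ii) summing over `v`, `Σ_S #{v : mult_S v = 1}` is even; (iii) every covering `5`-set has exactly one defect,
`#{v : mult_S v ≠ 1} + #{s ∈ S : |supp s| = 2} = 1`, from the degree count `14 ≤ Σ_v mult_S v = Σ_s |supp s| ≤ 15`
(`mult_add_quad_eq_one`); (iv) `Σ_S #{s ∈ S : |supp s| = 2} = Σ_{|supp q| = 2} N₄((supp q)ᶜ)` (remove `q`;
`card_filter_mem_cov_five`, `sum_card_quad`) is even. Hence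
`N₅ = Σ_S 1 = Σ_S #{v : mult_S v ≠ 1} + Σ_S #{s : |supp s| = 2} ≡ (14·N₅ − even) + even ≡ 0 (mod 2)`.

Sources: elementary double counting; the degree bound `|supp s| ≤ 3` is `ax_card_support_le`. Axioms: the standard three.
-/

set_option linter.dupNamespace false -- D-0017: single-problem summit ⇒ `QuantumAdvantage.QuantumAdvantage` by design

namespace Summit.QuantumAdvantage.QuantumAdvantage.Theorems.NearExactIsExact.Negative.CoverFiveParityFourteen

open Finset
open Summit.QuantumAdvantage.QuantumAdvantage.Theorems.CubicForrelation.NearExactIsExact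

/-! ### Covering `5`-sets of the `14` variables: parity bookkeeping -/

section Covering

variable {p : MvPolynomial (Fin (7 + 7)) (ZMod 2)}

/-- No `4` monomials of a polynomial of degree `≤ 3` cover more than `12` variables. [folklore] -/
theorem cov_four_eq_empty (hp : p.totalDegree ≤ 3) (K : Finset (Fin (7 + 7))) (hK : 12 < #K) :
    {S ∈ p.support.powerset | #S = 4 ∧ (S.biUnion fun s => s.support) = K} = ∅ := by
  rw [filter_eq_empty_iff]
  rintro S hS ⟨hS4, hSU⟩
  have h := ax_card_biUnion_le hp (mem_powerset.1 hS)
  rw [hSU, hS4] at h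
  omega

/-- Degree count: `Σ_v mult_S(v) = Σ_{s ∈ S} |supp s|`, `mult_S(v) = #{s ∈ S : v ∈ supp s}`. [folklore] -/
theorem sum_mult_eq (S : Finset (Fin (7 + 7) →₀ ℕ)) :
    ∑ v, #{s ∈ S | v ∈ s.support} = ∑ s ∈ S, #s.support := by
  simp_rw [card_filter]
  rw [sum_comm]
  refine sum_congr rfl fun s _ => ?_
  rw [sum_boole, Nat.cast_id, filter_mem_eq_inter, univ_inter]

/-- Double counting of pairs `(v, S)`. [folklore] -/
theorem sum_card_filter_comm (C : Finset (Finset (Fin (7 + 7) →₀ ℕ)))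
    (R : Fin (7 + 7) → Finset (Fin (7 + 7) →₀ ℕ) → Prop) [∀ v S, Decidable (R v S)] :
    ∑ v, #{S ∈ C | R v S} = ∑ S ∈ C, #{v ∈ (univ : Finset (Fin (7 + 7))) | R v S} := by
  simp_rw [card_filter]
  rw [sum_comm]

/-- **One defect per covering `5`-set.** If `5` monomials of degree `≤ 3` cover all `14` variables, then either
exactly one variable is covered twice and every member is a cubic, or the cover is exact and exactly one member is
a quadratic: `#{v : mult_S v ≠ 1} + #{s ∈ S : |supp s| = 2} = 1` (`14 ≤ Σ_s |supp s| = Σ_v mult_S v ≤ 15`).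
[this work; elementary] -/
theorem mult_add_quad_eq_one (hp : p.totalDegree ≤ 3) {S : Finset (Fin (7 + 7) →₀ ℕ)} (hSp : S ⊆ p.support)
    (hS5 : #S = 5) (hSU : (S.biUnion fun s => s.support) = univ) :
    #{v ∈ (univ : Finset (Fin (7 + 7))) | #{s ∈ S | v ∈ s.support} ≠ 1} + #{s ∈ S | #s.support = 2} = 1 := by
  have hσ := sum_mult_eq S
  have hpos : ∀ v, 1 ≤ #{s ∈ S | v ∈ s.support} := by
    intro v
    have hv : v ∈ S.biUnion fun s => s.support := by rw [hSU]; exact mem_univ _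
    obtain ⟨s, hs, hvs⟩ := mem_biUnion.1 hv
    exact card_pos.2 ⟨s, mem_filter.2 ⟨hs, hvs⟩⟩
  have hle3 : ∀ s ∈ S, #s.support ≤ 3 := fun s hs => ax_card_support_le hp (hSp hs)
  -- (F2) `14 + #B ≤ σ`
  have F2 : 14 + #{v ∈ (univ : Finset (Fin (7 + 7))) | #{s ∈ S | v ∈ s.support} ≠ 1} ≤
      ∑ v, #{s ∈ S | v ∈ s.support} := by
    have h := sum_le_sum (s := (univ : Finset (Fin (7 + 7))))
      (f := fun v => 1 + if #{s ∈ S | v ∈ s.support} ≠ 1 then 1 else 0)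
      (g := fun v => #{s ∈ S | v ∈ s.support}) fun v _ => by
        have h1 := hpos v
        split_ifs <;> omega
    rw [sum_add_distrib, sum_const, card_univ, Fintype.card_fin, smul_eq_mul, mul_one, sum_boole, Nat.cast_id] at h
    exact h
  -- (F3) `#B = 0 → σ = 14`
  have F3 : #{v ∈ (univ : Finset (Fin (7 + 7))) | #{s ∈ S | v ∈ s.support} ≠ 1} = 0 →
      ∑ v, #{s ∈ S | v ∈ s.support} = 14 := by
    intro h0
    rw [card_eq_zero, filter_eq_empty_iff] at h0
    rw [sum_congr rfl fun v _ => not_not.1 (h0 (mem_univ v)), sum_const, card_univ, Fintype.card_fin, smul_eq_mul]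
  -- (F4) `σ ≤ 5 + 2 #A + #Q`
  have F4 : ∑ s ∈ S, #s.support ≤ 5 + 2 * #{s ∈ S | #s.support = 3} + #{s ∈ S | #s.support = 2} := by
    have h := sum_le_sum (s := S) (f := fun s => #s.support)
      (g := fun s => 1 + (2 * (if #s.support = 3 then 1 else 0) + if #s.support = 2 then 1 else 0))
      fun s hs => by
        have h3 := hle3 s hs
        split_ifs <;> omega
    rw [sum_add_distrib, sum_const, smul_eq_mul, mul_one, hS5, sum_add_distrib, ← mul_sum, sum_boole, sum_boole,
      Nat.cast_id, Nat.cast_id] at h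
    omega
  -- (F5) `#A + #Q ≤ 5`
  have F5 : #{s ∈ S | #s.support = 3} + #{s ∈ S | #s.support = 2} ≤ 5 := by
    rw [← card_union_of_disjoint (disjoint_filter.2 fun s _ h3 h2 => by omega), ← filter_or, ← hS5]
    exact card_filter_le _ _
  -- (F7) `3 #A ≤ σ`
  have F7 : 3 * #{s ∈ S | #s.support = 3} ≤ ∑ s ∈ S, #s.support := by
    have h := sum_le_sum (s := S) (f := fun s => 3 * if #s.support = 3 then 1 else 0) (g := fun s => #s.support)
      fun s _ => by split_ifs <;> omega
    rw [← mul_sum, sum_boole, Nat.cast_id] at h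
    exact h
  omega

/-- The covering `5`-sets containing a given quadratic monomial `q`: remove `q` (bijection with the `4`-sets
covering `(supp q)ᶜ` exactly). [this work; elementary] -/
theorem filter_mem_cov_five_eq_image (hp : p.totalDegree ≤ 3) {q : Fin (7 + 7) →₀ ℕ} (hq : q ∈ p.support)
    (hq2 : #q.support = 2) :
    {S ∈ p.support.powerset | (#S = 5 ∧ (S.biUnion fun s => s.support) = univ) ∧ q ∈ S} =
      ({S' ∈ p.support.powerset | #S' = 4 ∧ (S'.biUnion fun s => s.support) = q.supportᶜ}).image (insert q) := by
  ext S
  constructor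
  · intro hS
    obtain ⟨hSp', ⟨hS5, hSU⟩, hqS⟩ := mem_filter.1 hS
    have hSp : S ⊆ p.support := mem_powerset.1 hSp'
    refine mem_image.2 ⟨S.erase q, mem_filter.2 ⟨mem_powerset.2 ((erase_subset _ _).trans hSp), ?_, ?_⟩,
      insert_erase hqS⟩
    · rw [card_erase_of_mem hqS, hS5]
    · symm
      apply eq_of_subset_of_card_le
      · intro v hv
        rw [mem_compl] at hv
        have hvU : v ∈ S.biUnion fun s => s.support := by rw [hSU]; exact mem_univ _
        obtain ⟨s, hs, hvs⟩ := mem_biUnion.1 hvU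
        have hsq : s ≠ q := by
          rintro rfl
          exact hv hvs
        exact mem_biUnion.2 ⟨s, mem_erase.2 ⟨hsq, hs⟩, hvs⟩
      · have h := ax_card_biUnion_le hp ((erase_subset q S).trans hSp)
        rw [card_erase_of_mem hqS, hS5] at h
        rw [card_compl, Fintype.card_fin, hq2]
        omega
  · intro hS
    obtain ⟨S', hS'F, rfl⟩ := mem_image.1 hS
    obtain ⟨hS'p', hS'4, hS'U⟩ := mem_filter.1 hS'F
    have hS'p : S' ⊆ p.support := mem_powerset.1 hS'p'
    have hqS' : q ∉ S' := by
      intro h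
      have hsub : q.support ⊆ S'.biUnion fun s => s.support := subset_biUnion_of_mem (fun s => s.support) h
      rw [hS'U, subset_compl_iff_disjoint_right, disjoint_self, bot_eq_empty] at hsub
      rw [hsub, card_empty] at hq2
      exact absurd hq2 (by norm_num)
    refine mem_filter.2 ⟨mem_powerset.2 (insert_subset hq hS'p), ⟨?_, ?_⟩, mem_insert_self _ _⟩
    · rw [card_insert_of_notMem hqS', hS'4]
    · rw [biUnion_insert, hS'U, union_compl]

/-- Counting version: the number of covering `5`-sets containing the quadratic monomial `q` is `N₄((supp q)ᶜ)`. -/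
theorem card_filter_mem_cov_five (hp : p.totalDegree ≤ 3) {q : Fin (7 + 7) →₀ ℕ} (hq : q ∈ p.support)
    (hq2 : #q.support = 2) :
    #{S ∈ p.support.powerset | (#S = 5 ∧ (S.biUnion fun s => s.support) = univ) ∧ q ∈ S} =
      #{S' ∈ p.support.powerset | #S' = 4 ∧ (S'.biUnion fun s => s.support) = q.supportᶜ} := by
  rw [filter_mem_cov_five_eq_image hp hq hq2]
  refine card_image_of_injOn fun S' hS' S'' hS'' h => ?_
  have key : ∀ T ∈ ({S' ∈ p.support.powerset | #S' = 4 ∧ (S'.biUnion fun s => s.support) = q.supportᶜ} :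
      Finset _), q ∉ T := by
    intro T hT hqT
    have hsub : q.support ⊆ T.biUnion fun s => s.support := subset_biUnion_of_mem (fun s => s.support) hqT
    rw [(mem_filter.1 hT).2.2, subset_compl_iff_disjoint_right, disjoint_self, bot_eq_empty] at hsub
    rw [hsub, card_empty] at hq2
    exact absurd hq2 (by norm_num)
  rw [← erase_insert (key S' (mem_coe.1 hS')), h, erase_insert (key S'' (mem_coe.1 hS''))]

/-- `Σ_S #{s ∈ S : |supp s| = 2} = Σ_{|supp q| = 2} N₄((supp q)ᶜ)` over the covering `5`-sets `S`
(double counting of pairs `(S, q)` and `card_filter_mem_cov_five`). [this work; elementary] -/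
theorem sum_card_quad (hp : p.totalDegree ≤ 3) :
    ∑ S ∈ {S ∈ p.support.powerset | #S = 5 ∧ (S.biUnion fun s => s.support) = univ}, #{s ∈ S | #s.support = 2} =
      ∑ q ∈ {q ∈ p.support | #q.support = 2},
        #{S' ∈ p.support.powerset | #S' = 4 ∧ (S'.biUnion fun s => s.support) = q.supportᶜ} := by
  have h1 : ∀ S ∈ {S ∈ p.support.powerset | #S = 5 ∧ (S.biUnion fun s => s.support) = univ},
      #{s ∈ S | #s.support = 2} = #{q ∈ {q ∈ p.support | #q.support = 2} | q ∈ S} := by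
    intro S hS
    have hSp : S ⊆ p.support := mem_powerset.1 (mem_filter.1 hS).1
    congr 1
    ext s
    simp only [mem_filter]
    constructor
    · rintro ⟨hs, h2⟩
      exact ⟨⟨hSp hs, h2⟩, hs⟩
    · rintro ⟨⟨-, h2⟩, hs⟩
      exact ⟨hs, h2⟩
  rw [sum_congr rfl h1]
  have h2 : ∑ S ∈ {S ∈ p.support.powerset | #S = 5 ∧ (S.biUnion fun s => s.support) = univ},
      #{q ∈ {q ∈ p.support | #q.support = 2} | q ∈ S} =
      ∑ q ∈ {q ∈ p.support | #q.support = 2},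
        #{S ∈ {S ∈ p.support.powerset | #S = 5 ∧ (S.biUnion fun s => s.support) = univ} | q ∈ S} := by
    simp_rw [card_filter]
    rw [sum_comm]
  rw [h2]
  refine sum_congr rfl fun q hq => ?_
  obtain ⟨hqp, hq2⟩ := mem_filter.1 hq
  rw [filter_filter, card_filter_mem_cov_five hp hqp hq2]

/-- **The covering `5`-sets in which a fixed variable `v` is simply covered**: removing the member through `v`
identifies them with the pairs `(s ∋ v, S')`, `S'` a `4`-set of monomials with `v ∉ U_{S'}`, `U_{S'} ∪ supp s = univ`.
[this work; elementary] -/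
theorem filter_simply_eq_biUnion (v : Fin (7 + 7)) :
    {S ∈ p.support.powerset | (#S = 5 ∧ (S.biUnion fun s => s.support) = univ) ∧
        #{s ∈ S | v ∈ s.support} = 1} =
      (p.support.filter fun s₀ => v ∈ s₀.support).biUnion fun s₀ =>
        (((univ : Finset (Fin (7 + 7))).powerset.filter fun K => v ∉ K ∧ K ∪ s₀.support = univ).biUnion
          fun K => {S' ∈ p.support.powerset | #S' = 4 ∧ (S'.biUnion fun s => s.support) = K}).image
          (insert s₀) := by
  ext S
  constructor
  · intro hS
    obtain ⟨hSp', ⟨hS5, hSU⟩, h1⟩ := mem_filter.1 hS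
    have hSp : S ⊆ p.support := mem_powerset.1 hSp'
    obtain ⟨s₀, hs₀⟩ := card_eq_one.1 h1
    have hs₀S : s₀ ∈ S ∧ v ∈ s₀.support := by
      have h := mem_filter.1 (hs₀ ▸ mem_singleton_self s₀)
      exact h
    have huniq : ∀ s ∈ S, v ∈ s.support → s = s₀ := fun s hs hvs =>
      mem_singleton.1 (hs₀ ▸ mem_filter.2 ⟨hs, hvs⟩)
    have hvU : v ∉ (S.erase s₀).biUnion fun s => s.support := by
      intro hv
      obtain ⟨s, hs, hvs⟩ := mem_biUnion.1 hv
      exact (mem_erase.1 hs).1 (huniq s (mem_erase.1 hs).2 hvs)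
    have hKU : ((S.erase s₀).biUnion fun s => s.support) ∪ s₀.support = univ := by
      rw [union_comm, ← biUnion_insert, insert_erase hs₀S.1, hSU]
    refine mem_biUnion.2 ⟨s₀, mem_filter.2 ⟨hSp hs₀S.1, hs₀S.2⟩, mem_image.2 ⟨S.erase s₀, ?_, insert_erase hs₀S.1⟩⟩
    refine mem_biUnion.2 ⟨(S.erase s₀).biUnion fun s => s.support,
      mem_filter.2 ⟨mem_powerset.2 (subset_univ _), hvU, hKU⟩, ?_⟩
    refine mem_filter.2 ⟨mem_powerset.2 ((erase_subset _ _).trans hSp), ?_, rfl⟩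
    rw [card_erase_of_mem hs₀S.1, hS5]
  · intro hS
    obtain ⟨s₀, hs₀F, hSim⟩ := mem_biUnion.1 hS
    obtain ⟨hs₀p, hvs₀⟩ := mem_filter.1 hs₀F
    obtain ⟨S', hS'B, rfl⟩ := mem_image.1 hSim
    obtain ⟨K, hK, hS'K⟩ := mem_biUnion.1 hS'B
    obtain ⟨-, hvK, hKU⟩ := mem_filter.1 hK
    obtain ⟨hS'p', hS'4, hS'U⟩ := mem_filter.1 hS'K
    have hS'p : S' ⊆ p.support := mem_powerset.1 hS'p'
    have hmem : ∀ s ∈ S', v ∉ s.support := by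
      intro s hs hvs
      have : v ∈ S'.biUnion fun s => s.support := mem_biUnion.2 ⟨s, hs, hvs⟩
      rw [hS'U] at this
      exact hvK this
    have hs₀S' : s₀ ∉ S' := fun h => hmem s₀ h hvs₀
    refine mem_filter.2 ⟨mem_powerset.2 (insert_subset hs₀p hS'p), ⟨?_, ?_⟩, ?_⟩
    · rw [card_insert_of_notMem hs₀S', hS'4]
    · rw [biUnion_insert, hS'U, union_comm, hKU]
    · rw [card_eq_one]
      refine ⟨s₀, ?_⟩
      ext s
      rw [mem_filter, mem_insert, mem_singleton]
      constructor
      · rintro ⟨h | h, hvs⟩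
        · exact h
        · exact absurd hvs (hmem s h)
      · rintro rfl
        exact ⟨Or.inl rfl, hvs₀⟩

/-- **Parity (i).** Under the hypotheses "`N₄(K)` is even for every `K` with `|K| ∈ {11, 12}`", the number of
covering `5`-sets in which `v` is simply covered is even. [this work] -/
theorem even_card_simply (hp : p.totalDegree ≤ 3)
    (h11 : ∀ K : Finset (Fin (7 + 7)), #K = 11 →
      Even #{S ∈ p.support.powerset | #S = 4 ∧ (S.biUnion fun s => s.support) = K})
    (h12 : ∀ K : Finset (Fin (7 + 7)), #K = 12 →
      Even #{S ∈ p.support.powerset | #S = 4 ∧ (S.biUnion fun s => s.support) = K})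
    (v : Fin (7 + 7)) :
    Even #{S ∈ p.support.powerset | (#S = 5 ∧ (S.biUnion fun s => s.support) = univ) ∧
      #{s ∈ S | v ∈ s.support} = 1} := by
  -- the inner families and their parities
  have hinner : ∀ s₀ ∈ p.support.filter (fun s₀ => v ∈ s₀.support),
      Even #((((univ : Finset (Fin (7 + 7))).powerset.filter fun K => v ∉ K ∧ K ∪ s₀.support = univ).biUnion
          fun K => {S' ∈ p.support.powerset | #S' = 4 ∧ (S'.biUnion fun s => s.support) = K})) := by
    intro s₀ hs₀
    have hs₀3 : #s₀.support ≤ 3 := ax_card_support_le hp (mem_filter.1 hs₀).1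
    rw [card_biUnion]
    · refine even_sum _ fun K hK => ?_
      obtain ⟨-, -, hKU⟩ := mem_filter.1 hK
      have hK11 : 11 ≤ #K := by
        have h := card_union_le K s₀.support
        rw [hKU, card_univ, Fintype.card_fin] at h
        omega
      have hK14 : #K ≤ 14 := (card_le_univ K).trans_eq (Fintype.card_fin _)
      rcases (show #K = 11 ∨ #K = 12 ∨ 12 < #K by omega) with h | h | h
      · exact h11 K h
      · exact h12 K h
      · rw [cov_four_eq_empty hp K h, card_empty]
        exact ⟨0, rfl⟩
    · intro K _ K' _ hne
      exact disjoint_left.2 fun S' hS' hS'' => hne ((mem_filter.1 hS').2.2.symm.trans (mem_filter.1 hS'').2.2)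
  -- no member of an inner `4`-set contains `v`
  have key : ∀ s₀ ∈ p.support.filter (fun s₀ => v ∈ s₀.support),
      ∀ S' ∈ (((univ : Finset (Fin (7 + 7))).powerset.filter fun K => v ∉ K ∧ K ∪ s₀.support = univ).biUnion
          fun K => {S' ∈ p.support.powerset | #S' = 4 ∧ (S'.biUnion fun s => s.support) = K}),
        ∀ s ∈ S', v ∉ s.support := by
    intro s₀ _ S' hS' s hs hvs
    obtain ⟨K, hK, hS'K⟩ := mem_biUnion.1 hS'
    have hv : v ∈ S'.biUnion fun s => s.support := mem_biUnion.2 ⟨s, hs, hvs⟩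
    rw [(mem_filter.1 hS'K).2.2] at hv
    exact (mem_filter.1 hK).2.1 hv
  have hdisj : ((p.support.filter fun s₀ => v ∈ s₀.support : Finset _) : Set _).PairwiseDisjoint fun s₀ =>
      (((univ : Finset (Fin (7 + 7))).powerset.filter fun K => v ∉ K ∧ K ∪ s₀.support = univ).biUnion
          fun K => {S' ∈ p.support.powerset | #S' = 4 ∧ (S'.biUnion fun s => s.support) = K}).image
        (insert s₀) := by
    intro s₀ hs₀ s₁ hs₁ hne
    rw [Function.onFun, disjoint_left]
    intro S hS hS1
    obtain ⟨S', hS', rfl⟩ := mem_image.1 hS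
    obtain ⟨S'', hS'', hEq⟩ := mem_image.1 hS1
    have hs₁S : s₁ ∈ insert s₀ S' := by
      rw [← hEq]
      exact mem_insert_self _ _
    rcases mem_insert.1 hs₁S with h | h
    · exact hne h.symm
    · exact key s₀ (mem_coe.1 hs₀) S' hS' s₁ h (mem_filter.1 (mem_coe.1 hs₁)).2
  rw [filter_simply_eq_biUnion v, card_biUnion hdisj]
  refine even_sum _ fun s₀ hs₀ => ?_
  rw [card_image_of_injOn]
  · exact hinner s₀ hs₀
  · intro S' hS' S'' hS'' h
    have h1 : s₀ ∉ S' := fun hm => key s₀ hs₀ S' (mem_coe.1 hS') s₀ hm (mem_filter.1 hs₀).2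
    have h2 : s₀ ∉ S'' := fun hm => key s₀ hs₀ S'' (mem_coe.1 hS'') s₀ hm (mem_filter.1 hs₀).2
    rw [← erase_insert h1, h, erase_insert h2]

/-- **`N₅(univ)` is even** under the parity hypotheses on `N₄` of the `11`- and `12`-sets. [this work] -/
theorem even_cov_five (hp : p.totalDegree ≤ 3)
    (h11 : ∀ K : Finset (Fin (7 + 7)), #K = 11 →
      Even #{S ∈ p.support.powerset | #S = 4 ∧ (S.biUnion fun s => s.support) = K})
    (h12 : ∀ K : Finset (Fin (7 + 7)), #K = 12 →
      Even #{S ∈ p.support.powerset | #S = 4 ∧ (S.biUnion fun s => s.support) = K}) :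
    Even #{S ∈ p.support.powerset | #S = 5 ∧ (S.biUnion fun s => s.support) = univ} := by
  set C := {S ∈ p.support.powerset | #S = 5 ∧ (S.biUnion fun s => s.support) = univ} with hC
  -- (iv) the quadratic members
  have hQ : Even (∑ S ∈ C, #{s ∈ S | #s.support = 2}) := by
    rw [hC, sum_card_quad hp]
    refine even_sum _ fun q hq => h12 _ ?_
    rw [card_compl, Fintype.card_fin, (mem_filter.1 hq).2]
  -- (ii) the simply covered vertices
  have hS : Even (∑ S ∈ C, #{v ∈ (univ : Finset (Fin (7 + 7))) | #{s ∈ S | v ∈ s.support} = 1}) := by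
    rw [← sum_card_filter_comm C fun v S => #{s ∈ S | v ∈ s.support} = 1]
    refine even_sum _ fun v _ => ?_
    rw [hC, filter_filter]
    exact even_card_simply hp h11 h12 v
  -- (iii) one defect per covering set
  have hB : Even (∑ S ∈ C, #{v ∈ (univ : Finset (Fin (7 + 7))) | #{s ∈ S | v ∈ s.support} ≠ 1}) := by
    have htot : ∑ S ∈ C, #{v ∈ (univ : Finset (Fin (7 + 7))) | #{s ∈ S | v ∈ s.support} = 1} +
        ∑ S ∈ C, #{v ∈ (univ : Finset (Fin (7 + 7))) | #{s ∈ S | v ∈ s.support} ≠ 1} = 14 * #C := by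
      rw [← sum_add_distrib, sum_congr rfl fun S _ => card_filter_add_card_filter_not _, sum_const,
        card_univ, Fintype.card_fin, smul_eq_mul, mul_comm]
    have h14 : Even (14 * #C) := ⟨7 * #C, by ring⟩
    rw [← htot] at h14
    exact (Nat.even_add.1 h14).1 hS
  have hone : #C = ∑ S ∈ C, (#{v ∈ (univ : Finset (Fin (7 + 7))) | #{s ∈ S | v ∈ s.support} ≠ 1} +
      #{s ∈ S | #s.support = 2}) := by
    rw [card_eq_sum_ones, sum_congr rfl fun S hS => ?_]
    obtain ⟨hSp, hS5, hSU⟩ := mem_filter.1 hS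
    exact (mult_add_quad_eq_one hp (mem_powerset.1 hSp) hS5 hSU).symm
  rw [hone, sum_add_distrib]
  exact hB.add hQ

end Covering
end Summit.QuantumAdvantage.QuantumAdvantage.Theorems.NearExactIsExact.Negative.CoverFiveParityFourteen
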